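import Summits.ResolutionOfSingularities.ResolutionOfSingularities.Theorems.HilbertSamuelEliminationCampaignW42ProjDirectrixOfPerfect
import Summits.ResolutionOfSingularities.ResolutionOfSingularities.Theorems.HilbertSamuelEliminationCampaignW42RidgeRationalDirectrix
import Mathlib.RingTheory.MvPolynomial.Tower
import HarnessLib

/-!
# [OURS · L1 W4.2] CJS Thm. 3.14 AT RATIONAL NEAR POINTS, EVERY CHARACTERISTIC: a near point `x'` of the blow-up of a point
# `x` with `κ(x) ⥲ κ(x')` lies on the projectivised DIRECTRIX `ℙ(Dir_x X)` — no characteristic, perfectness or `e = ē`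
# hypothesis (campaign s42, cell res-hironaka; informal crux `RidgeConfinement`, stmt-ResolutionOfSingularities-17845, and the
# W-top door of chain w42, stmt-ResolutionOfSingularities-19249; `--supports`)

HONEST FRAMING. OURS (slot W4.2, prover res-L1-s42-pv-1, gen 6). [OURS · L1 W4.2] replaces the role of nothing printed in
H. Hironaka's manuscript. CJS LNM 2270 Thm. 3.14 (near points lie on `ℙ(Dir_x(X)/T_x(D))`) needs `char κ(x) = 0` or
`≥ dim X/2 + 1` (obstruction O1, Hironaka's quadric over `𝔽₂(λ, μ)`); the tree proved it unconditionally when `κ(x)` is PERFECT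
(`isOnProjDirectrix_of_isNearPoint_of_perfectField`, gen 3) or `e_x = ē_x` (`…_of_dirDim_eq_geomDirDim`, gen 4). This file adds the
case of a RATIONAL near point — `κ(x) → κ(x')` bijective, `κ(x)` ARBITRARY (imperfect allowed), any characteristic: the direction
of `x'` is a `κ(x)`-rational point of Giraud's ridge (`mem_localRidge_of_isNearPoint_point`, gen 3), and rational points of the
ridge are directrix points (`aeval_eq_zero_of_mem_ridge_of_mem_directrixSpace`, `…CampaignW42RidgeRationalDirectrix`). In
Hironaka's quadric the near points are NOT rational (its ridge has no rational point but the vertex), consistently.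

* `isOnProjDirectrix_of_isNearPoint_of_bijective` — local form (`D` with `𝓘_{D,x} = 𝔪_x` permissible at `x = π x'`,
  `𝒪_{X,x}` universally catenary, `x'` near at level `N`, `κ(x) → κ(x')` bijective);
* `isOnProjDirectrix_of_near_of_bijective` — door form: `X` excellent, `x` closed with `0 < dim 𝒪_{X,x}`, `π` the blow-up in
  `{x}`, `x'` over `x` near at level `N` with `κ(x) ⥲ κ(x')`.

NOT a statement of H. Hironaka's manuscript [Hironaka2017]. AI review is weaker than expert review. References (orientation
only): V. Cossart, U. Jannsen, S. Saito, LNM 2270 (2020), Thm. 3.14, §1.3 (O1), Def. 6.34; J. Giraud, *Bull. Sci. Math.* 99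
(1975) §1.5.
-/

noncomputable section

-- single-conjunct summit: the doubled namespace component `ResolutionOfSingularities` is mandated
set_option linter.dupNamespace false

open CategoryTheory AlgebraicGeometry IsLocalRing MvPolynomial
open Literature.RingTheory.HilbertSamuel Literature.RingTheory.MvPolynomial
open Literature.AlgebraicGeometry.Resolution Literature.AlgebraicGeometry.CossartJannsenSaito2020

namespace Summit.ResolutionOfSingularities.ResolutionOfSingularities.Theorems

namespace CampaignW42

universe u

section Point

variable {X X' : Scheme.{u}} [IsLocallyNoetherian X] [IsLocallyNoetherian X'] {π : X' ⟶ X} {D : X.IdealSheafData}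

-- (`maxHeartbeats`: the stalks of a scheme carry their ring structure through `CommRingCat`; matching the instance
-- paths of `κ(x) → κ(x')` produced here against those inside `IsOnProjDirectrix` is correct but slow)
set_option maxHeartbeats 800000 in
omit [IsLocallyNoetherian X'] in
/-- **Near points of the blow-up of a point with BIJECTIVE residue field map lie on the projectivised directrix — every
characteristic, every `κ(x)`.** Same setting as `isOnProjDirectrix_of_isNearPoint_of_perfectField`; the hypothesis `κ(x)` perfect
is replaced by `κ(x) → κ(x')` bijective. [cite: CossartJannsenSaito2020, Thm. 3.14, Def. 6.34] [cite: Giraud1975, §1.5] -/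
theorem isOnProjDirectrix_of_isNearPoint_of_bijective (hπ : IsBlowup π D) (x' : X')
    (hperm : IdealSheafData.IsPermissibleAt D (π.base x'))
    (hUC : IsUniversallyCatenaryRing (X.presheaf.stalk (π.base x')))
    (hD : stalkIdeal D (π.base x') = maximalIdeal (X.presheaf.stalk (π.base x')))
    (hbij : Function.Bijective (π.residueFieldMap x').hom)
    {N : ℕ} (hnear : IsNearPoint π N x') : IsOnProjDirectrix π x' := by
  classical
  intro L hL c hc
  letI algκ : Algebra (ResidueField (X.presheaf.stalk (π.base x'))) (ResidueField (X'.presheaf.stalk x')) :=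
    (ResidueField.map (π.stalkMap x').hom).toAlgebra
  have hx : Ideal.span (Set.range (minGenerators (X.presheaf.stalk (π.base x')))) = maximalIdeal (X.presheaf.stalk (π.base x')) := span_range_minGenerators _
  -- a chart through `x'` for the generators `x` of `𝓘_{D,x} = 𝔪_x`
  obtain ⟨j, 𝔴, χ, hχ, hloc, h𝔴⟩ := hπ.exists_reesChart_stalk x' (minGenerators (X.presheaf.stalk (π.base x'))) (hx.trans hD.symm)
  letI algCO : Algebra (chartRing (minGenerators (X.presheaf.stalk (π.base x'))) j) (X'.presheaf.stalk x') := χ.toAlgebra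
  haveI : IsLocalization.AtPrime (X'.presheaf.stalk x') 𝔴.asIdeal := hloc
  have hū := mem_localRidge_of_isNearPoint_point x' hperm hUC hD hnear j 𝔴 χ hχ hloc h𝔴
  -- the inverse `ψ : κ(x') → κ(x)` of the bijective residue map, as a `κ(x)`-algebra map
  have hbij' : Function.Bijective (ResidueField.map (π.stalkMap x').hom) := hbij
  let eκ : ResidueField (X.presheaf.stalk (π.base x')) ≃+* ResidueField (X'.presheaf.stalk x') :=
    RingEquiv.ofBijective (ResidueField.map (π.stalkMap x').hom) hbij'
  let ψ : ResidueField (X'.presheaf.stalk x') →ₐ[ResidueField (X.presheaf.stalk (π.base x'))]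
      ResidueField (X.presheaf.stalk (π.base x')) :=
    { eκ.symm.toRingHom with
      commutes' := fun a => by
        show eκ.symm (algebraMap _ _ a) = a
        exact eκ.symm_apply_apply a }
  -- the `κ(x)`-RATIONAL point `u = ψ(ū)` of the ridge is a point of the directrix
  have hJ : IsHomogeneousIdeal (canonicalTangentConeIdeal (X.presheaf.stalk (π.base x'))) := isHomogeneousIdeal_tangentConeIdeal _ _
  have hu := map_mem_ridge ψ ((mem_localRidge_iff _).mp hū)
  have hLu := aeval_eq_zero_of_mem_ridge_of_mem_directrixSpace hJ hu hL
  have hLū : aeval (fun i => residue (X'.presheaf.stalk x') (χ (chartGen (minGenerators (X.presheaf.stalk (π.base x'))) j i))) L = 0 := by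
    have hback : (fun i => algebraMap (ResidueField (X.presheaf.stalk (π.base x'))) (ResidueField (X'.presheaf.stalk x'))
        (ψ (residue (X'.presheaf.stalk x') (χ (chartGen (minGenerators (X.presheaf.stalk (π.base x'))) j i))))) =
        fun i => residue (X'.presheaf.stalk x') (χ (chartGen (minGenerators (X.presheaf.stalk (π.base x'))) j i)) := by
      funext i
      exact eκ.apply_symm_apply _
    rw [← hback]
    change aeval (algebraMap (ResidueField (X.presheaf.stalk (π.base x'))) (ResidueField (X'.presheaf.stalk x')) ∘
      fun i => ψ (residue (X'.presheaf.stalk x') (χ (chartGen (minGenerators (X.presheaf.stalk (π.base x'))) j i)))) L = 0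
    rw [MvPolynomial.aeval_algebraMap_apply, hLu, map_zero]
  -- `L = Σ_i (coeff_i L) X_i`
  obtain ⟨w, hwL⟩ : ∃ w, linForm w = L := by
    have h1 : L ∈ LinearMap.range (linForm (K := ResidueField (X.presheaf.stalk (π.base x')))
        (n := (maximalIdeal (X.presheaf.stalk (π.base x'))).spanFinrank)) := by
      rw [range_linForm]; exact directrixSpace_le_one _ hL
    exact LinearMap.mem_range.mp h1
  have hcoeff : ∀ i, MvPolynomial.coeff (Finsupp.single i 1) L = w i := fun i => by
    rw [← hwL, linForm_apply, coeff_sum, Finset.sum_eq_single i]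
    · rw [coeff_smul, coeff_X, if_pos rfl, smul_eq_mul, mul_one]
    · intro b _ hb
      rw [coeff_smul, coeff_X, if_neg (fun h => hb (Finsupp.single_left_injective one_ne_zero h)), smul_zero]
    · exact fun h => (h (Finset.mem_univ i)).elim
  -- `π♯(x_i) = χ(e_i) · π♯(x_j)`, `π♯(x_j) ∈ 𝔪_x 𝒪'`, and `Σ_i c̄_i ū_i = L(ū) = 0`
  have hcl : ∀ i, (π.stalkMap x').hom (minGenerators (X.presheaf.stalk (π.base x')) i) =
      χ (chartGen (minGenerators (X.presheaf.stalk (π.base x'))) j i) * (π.stalkMap x').hom (minGenerators (X.presheaf.stalk (π.base x')) j) := fun i => by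
    rw [← hχ, ← hχ, reesChartBase_apply_eq_mul_chartGen (minGenerators (X.presheaf.stalk (π.base x'))) j i, map_mul, mul_comm]
  have ht : (π.stalkMap x').hom (minGenerators (X.presheaf.stalk (π.base x')) j) ∈
      (maximalIdeal (X.presheaf.stalk (π.base x'))).map (π.stalkMap x').hom :=
    Ideal.mem_map_of_mem _ (by rw [← hx]; exact Ideal.subset_span ⟨j, rfl⟩)
  have hL' : aeval (fun i => residue (X'.presheaf.stalk x') (χ (chartGen (minGenerators (X.presheaf.stalk (π.base x'))) j i))) (linForm w) = 0 :=
    hwL ▸ hLū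
  have h0 := (aeval_linForm_eq_sum w _).symm.trans hL'
  exact map_sum_mul_mem_of_residue_sum_eq_zero (π.stalkMap x').hom (minGenerators (X.presheaf.stalk (π.base x'))) c
    (fun i => χ (chartGen (minGenerators (X.presheaf.stalk (π.base x'))) j i)) _ hcl ht w (fun i => (hc i).trans (hcoeff i)) h0

end Point

/-! ## The door's shape: blow-up of a closed point of an excellent scheme -/

section Door

variable {X X' : Scheme.{u}} [IsLocallyNoetherian X] {π : X' ⟶ X} {x : X}

/-- **W-top / CJS-3.14 confinement at a RATIONAL near point, unconditional, every characteristic.** `X` excellent and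
locally noetherian, `x` a closed point with `0 < dim 𝒪_{X,x}` (ANY residue field), `π : X' → X` the blow-up in `{x}`, `x'` a
point over `x` NEAR at level `N` (`H^N_{X'}(x') = H^N_X(x)`) whose residue field map `κ(x) → κ(x')` is bijective: then
`IsOnProjDirectrix π x'`. [cite: CossartJannsenSaito2020, Thm. 3.14, Def. 6.34] [cite: Giraud1975, §1.5] -/
theorem isOnProjDirectrix_of_near_of_bijective (hX : Scheme.IsExcellent X) (hx : IsClosed ({x} : Set X))
    (hπ : IsBlowup π (Scheme.IdealSheafData.vanishingIdeal ⟨{x}, hx⟩))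
    (hpos : 0 < ringKrullDim (X.presheaf.stalk x))
    {N : ℕ} {x' : X'} (hxx' : π.base x' = x) (hnear : Scheme.hsFun X' N x' = Scheme.hsFun X N x)
    (hbij : Function.Bijective (π.residueFieldMap x').hom) :
    IsOnProjDirectrix π x' := by
  subst hxx'
  have hperm : IdealSheafData.IsPermissibleAt (Scheme.IdealSheafData.vanishingIdeal ⟨{π.base x'}, hx⟩) (π.base x') := by
    rw [IdealSheafData.isPermissibleAt_iff, stalkIdeal_vanishingIdeal_singleton hx]
    exact (isPermissible_maximalIdeal_iff _).mpr fun hmin => by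
      have h0 : (maximalIdeal (X.presheaf.stalk (π.base x'))).height = 0 := Ideal.height_eq_zero_iff.mpr hmin
      have hdim : ringKrullDim (X.presheaf.stalk (π.base x')) = 0 := by
        rw [← IsLocalRing.maximalIdeal_height_eq_ringKrullDim, h0]; rfl
      rw [hdim] at hpos
      exact lt_irrefl _ hpos
  exact isOnProjDirectrix_of_isNearPoint_of_bijective hπ x' hperm (hX.isUniversallyCatenaryRing_stalk _)
    (stalkIdeal_vanishingIdeal_singleton hx) hbij (N := N) hnear

/-- **The same with `IsIso (π.residueFieldMap x')`** (the form produced by the tree's `ProjDir_line` door).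
[cite: CossartJannsenSaito2020, Thm. 3.14, Def. 6.34 (i)] -/
theorem isOnProjDirectrix_of_near_of_isIso_residueFieldMap (hX : Scheme.IsExcellent X) (hx : IsClosed ({x} : Set X))
    (hπ : IsBlowup π (Scheme.IdealSheafData.vanishingIdeal ⟨{x}, hx⟩))
    (hpos : 0 < ringKrullDim (X.presheaf.stalk x))
    {N : ℕ} {x' : X'} (hxx' : π.base x' = x) (hnear : Scheme.hsFun X' N x' = Scheme.hsFun X N x)
    [IsIso (π.residueFieldMap x')] : IsOnProjDirectrix π x' :=
  isOnProjDirectrix_of_near_of_bijective hX hx hπ hpos hxx' hnear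
    (ConcreteCategory.bijective_of_isIso (π.residueFieldMap x'))

end Door

end CampaignW42

end Summit.ResolutionOfSingularities.ResolutionOfSingularities.Theorems

end
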